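import Summits.AtomisticToContinuum.FouriersLaw.Theorems.HiddenChargeMazurOddChargeAlgebraToolkitB

/-!
# Odd conservation laws of the pinned anharmonic chain — the rows of the strain identity

File `PairLinearRows` of the NEGATIVE edge of crux `HiddenChargeMazur.OddChargeExists`
(item stmt-AtomisticToContinuum-13511).  For a leading p-linear member
`F = Σ_{y=0}^{D} a_y p_y` (`a_y ∈ ℝ[q_0, …, q_D]`) of span `D` with partner `H` (a polynomial on
the sites `0, …, D-1`) the strain equation `(β) A⁺F + B↑_{D-1} H = 0` is differentiated along the
momenta:

* `bup_plinear` — `B↑_D F = cub(q_{D+1},q_D)·a_D + cub(q_0,q_1)·S a_0` (`0 ≤ D`; MATH §4.1);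
* `pair_linear_rows` (`1 ≤ D`) — Row `0` and Row `D` of `(β)` (`∂_{p_0}`, `∂_{p_D}`; §4.2,
  `plin_row_zero`, `plin_row_D`), the transport identities `(★)_y` (§4.3, `plin_transport`),
  `(H2) ∂_{q_0} a_D + ∂_{q_D} a_0 = 0` (`plin_h2`), and the restricted entries
  `killVar q_D (∂_{q_x} a_y + ∂_{q_y} a_x) = -killVar q_D (cub(q_0,q_1))·W_{xy}` with `W_{xy}`
  free of `q_0` and `W_{0y} = W_{x0} = 0` (§4.5, first half; `plin_restricted`).

Everything is elementary differential calculus in `𝓡 = ℝ[q_x, p_x : x ∈ ℤ]`: `∂_{p_x}` of a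
p-linear polynomial extracts a coefficient, `[∂_{p_x}, A⁺] = ∂_{q_x}`, the cubics `cub` are
momentum-free, and `H` has no variable off the sites `0, …, D-1`. [folklore]
-/

noncomputable section

open MvPolynomial
open scoped BigOperators

namespace Summit.AtomisticToContinuum.FouriersLaw.Theorems.OddChargeAlgebra

/-! ### Private toolkit: momentum-linear polynomials `Σ_z b_z p_z` -/

/-- `∂_{p_x} (Σ_{z ∈ s} b_z p_z)` is `b_x` (`x ∈ s`) or `0` (`x ∉ s`) when the `b_z` are free of
`p_x`. [folklore] -/
private theorem pderiv_inr_plin' {s : Finset ℤ} {b : ℤ → R} {x : ℤ}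
    (hb : ∀ z, pderiv (Sum.inr x) (b z) = 0) :
    pderiv (Sum.inr x) (∑ z ∈ s, b z * X (Sum.inr z)) = if x ∈ s then b x else 0 := by
  have key : ∀ z ∈ s,
      pderiv (Sum.inr x) (b z * X (Sum.inr z) : R) = if x = z then b z else 0 := by
    intro z _
    rw [pderiv_mul, hb z, zero_mul, zero_add]
    by_cases h : x = z
    · subst h
      rw [pderiv_X_self, mul_one, if_pos rfl]
    · rw [pderiv_X_of_ne (fun e => h (Sum.inr_injective e).symm), mul_zero, if_neg h]
  rw [map_sum, Finset.sum_congr rfl key, Finset.sum_ite_eq]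

/-- `∂_{q_x} (Σ_{z ∈ s} b_z p_z) = Σ_z (∂_{q_x} b_z) p_z`. [folklore] -/
private theorem pderiv_inl_plin' (s : Finset ℤ) (b : ℤ → R) (x : ℤ) :
    pderiv (Sum.inl x) (∑ z ∈ s, b z * X (Sum.inr z)) =
      ∑ z ∈ s, pderiv (Sum.inl x) (b z) * X (Sum.inr z) := by
  rw [map_sum]
  refine Finset.sum_congr rfl fun z _ => ?_
  rw [pderiv_mul, pderiv_X_of_ne Sum.inr_ne_inl, mul_zero, add_zero]

/-! ### Private toolkit: supports -/

/-- The coefficients `a_y ∈ ℝ[q_0, …, q_D]` are momentum-free. [folklore] -/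
private theorem pderiv_inr_coef' {D : ℤ} {a : ℤ → R}
    (ha : ∀ y, a y ∈ supported ℝ (Sum.inl '' Set.Icc (0 : ℤ) D)) (k y : ℤ) :
    pderiv (Sum.inr k) (a y) = 0 :=
  pderiv_eq_zero_of_not_mem_supported (ha y) (by
    rintro ⟨x, -, hx⟩
    exact Sum.inl_ne_inr hx)

/-- The position derivatives of the coefficients are momentum-free. [folklore] -/
private theorem pderiv_inr_pderiv_coef' {D : ℤ} {a : ℤ → R}
    (ha : ∀ y, a y ∈ supported ℝ (Sum.inl '' Set.Icc (0 : ℤ) D)) (k j y : ℤ) :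
    pderiv (Sum.inr k) (pderiv (Sum.inl j) (a y)) = 0 := by
  rw [pderiv_comm, pderiv_inr_coef' ha, map_zero]

/-- `∂_{p_k} A⁺ a_y = ∂_{q_k} a_y`. [folklore] -/
private theorem pderiv_inr_Aplus_coef' {D : ℤ} {a : ℤ → R}
    (ha : ∀ y, a y ∈ supported ℝ (Sum.inl '' Set.Icc (0 : ℤ) D)) (k y : ℤ) :
    pderiv (Sum.inr k) (Aplus (a y)) = pderiv (Sum.inl k) (a y) := by
  rw [pderiv_inr_Aplus, pderiv_inr_coef' ha, map_zero, zero_add]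

/-- `killP` fixes the position derivatives of the coefficients. [folklore] -/
private theorem killP_pderiv_coef' {D : ℤ} {a : ℤ → R}
    (ha : ∀ y, a y ∈ supported ℝ (Sum.inl '' Set.Icc (0 : ℤ) D)) (j y : ℤ) :
    killP (pderiv (Sum.inl j) (a y)) = pderiv (Sum.inl j) (a y) :=
  killP_eq_self_of_mem
    (pderiv_mem_supported (supported_mono (Set.image_subset_range _ _) (ha y)) _)

/-- `(if x ∈ [0, D] then ∂_v a_x else 0) = ∂_v a_x`, as `a_x = 0` off `[0, D]`. [folklore] -/
private theorem ite_pderiv_coef' {D : ℤ} {a : ℤ → R}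
    (hout : ∀ y, y < 0 ∨ D < y → a y = 0) (v : Var) (x : ℤ) :
    (if x ∈ Finset.Icc 0 D then pderiv v (a x) else 0) = pderiv v (a x) := by
  split_ifs with h
  · rfl
  · rw [hout x (by rw [Finset.mem_Icc] at h; omega), map_zero]

/-- A polynomial on the sites `0, …, D-1` is free of every momentum off these sites. [folklore] -/
private theorem pderiv_inr_eq_zero_of_site' {D : ℤ} {f : R}
    (hf : f ∈ supported ℝ (Var.site ⁻¹' Set.Icc (0 : ℤ) (D - 1))) {k : ℤ}
    (hk : k < 0 ∨ D - 1 < k) : pderiv (Sum.inr k) f = 0 :=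
  pderiv_eq_zero_of_not_mem_supported hf fun h => by
    have h' : 0 ≤ k ∧ k ≤ D - 1 := h
    omega

/-- A polynomial on the sites `0, …, D-1` is free of every position off these sites. [folklore] -/
private theorem pderiv_inl_eq_zero_of_site' {D : ℤ} {f : R}
    (hf : f ∈ supported ℝ (Var.site ⁻¹' Set.Icc (0 : ℤ) (D - 1))) {k : ℤ}
    (hk : k < 0 ∨ D - 1 < k) : pderiv (Sum.inl k) f = 0 :=
  pderiv_eq_zero_of_not_mem_supported hf fun h => by
    have h' : 0 ≤ k ∧ k ≤ D - 1 := h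
    omega

/-- `killP` fixes `cub(q_i, q_j)`. [folklore] -/
private theorem killP_cub' (i j : ℤ) :
    killP (cub (X (Sum.inl i)) (X (Sum.inl j)) : R) = cub (X (Sum.inl i)) (X (Sum.inl j)) :=
  killP_eq_self_of_mem
    (cub_mem_supported (X_mem_supported.mpr ⟨i, rfl⟩) (X_mem_supported.mpr ⟨j, rfl⟩))

/-! ### The boundary operator on a p-linear polynomial -/

/-- **`B↑_D` of a p-linear polynomial** (MATH §4.1): for `F = Σ_{y=0}^{D} a_y p_y` with
momentum-free coefficients, `B↑_D F = cub(q_{D+1}, q_D)·a_D + cub(q_0, q_1)·S a_0` (`0 ≤ D`, so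
that both ends `0` and `D` are actual sites of `F`). [folklore] -/
theorem bup_plinear : ∀ (D : ℤ) (a : ℤ → R), 0 ≤ D →
    (∀ y, a y ∈ supported ℝ (Sum.inl '' Set.Icc (0 : ℤ) D)) →
    bup D (∑ y ∈ Finset.Icc 0 D, a y * X (Sum.inr y)) =
      cub (X (Sum.inl (D + 1))) (X (Sum.inl D)) * a D
        + cub (X (Sum.inl 0)) (X (Sum.inl 1)) * shift (a 0) := by
  intro D a hD ha
  rw [bup, pderiv_inr_plin' (pderiv_inr_coef' ha D), pderiv_inr_plin' (pderiv_inr_coef' ha 0),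
    if_pos (Finset.mem_Icc.mpr ⟨hD, le_rfl⟩), if_pos (Finset.mem_Icc.mpr ⟨le_rfl, hD⟩)]

/-! ### Momentum derivatives of the two halves of the strain identity -/

/-- `∂_{p_x} A⁺F = A⁺ a_x + Σ_z (∂_{q_x} a_z) p_z` for `x ∈ [0, D]`. [folklore] -/
private theorem pderiv_inr_Aplus_plin' {D : ℤ} {a : ℤ → R}
    (ha : ∀ y, a y ∈ supported ℝ (Sum.inl '' Set.Icc (0 : ℤ) D)) {x : ℤ}
    (hx : x ∈ Finset.Icc 0 D) :
    pderiv (Sum.inr x) (Aplus (∑ z ∈ Finset.Icc 0 D, a z * X (Sum.inr z))) =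
      Aplus (a x) + ∑ z ∈ Finset.Icc 0 D, pderiv (Sum.inl x) (a z) * X (Sum.inr z) := by
  rw [pderiv_inr_Aplus, pderiv_inr_plin' (pderiv_inr_coef' ha x), if_pos hx, pderiv_inl_plin']

/-- `∂_{p_k} (A⁺ a_x + Σ_z (∂_{q_x} a_z) p_z) = ∂_{q_k} a_x + ∂_{q_x} a_k` (for every `k ∈ ℤ`,
as `a_k = 0` off `[0, D]`). [folklore] -/
private theorem pderiv_inr_row' {D : ℤ} {a : ℤ → R}
    (ha : ∀ y, a y ∈ supported ℝ (Sum.inl '' Set.Icc (0 : ℤ) D))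
    (hout : ∀ y, y < 0 ∨ D < y → a y = 0) (x k : ℤ) :
    pderiv (Sum.inr k)
        (Aplus (a x) + ∑ z ∈ Finset.Icc 0 D, pderiv (Sum.inl x) (a z) * X (Sum.inr z)) =
      pderiv (Sum.inl k) (a x) + pderiv (Sum.inl x) (a k) := by
  rw [map_add, pderiv_inr_Aplus_coef' ha, pderiv_inr_plin' (pderiv_inr_pderiv_coef' ha k x),
    ite_pderiv_coef' hout]

/-- `∂_{p_k} B↑_{D-1} H
  = cub(q_D, q_{D-1})·∂_{p_k}∂_{p_{D-1}} H + cub(q_0, q_1)·S(∂_{p_{k-1}}∂_{p_0} H)`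
(`cub` is momentum-free, `∂_{p_k} ∘ S = S ∘ ∂_{p_{k-1}}`). [folklore] -/
private theorem pderiv_inr_bup_pred' (D k : ℤ) (H : R) :
    pderiv (Sum.inr k) (bup (D - 1) H) =
      cub (X (Sum.inl D)) (X (Sum.inl (D - 1))) * pderiv (Sum.inr k) (pderiv (Sum.inr (D - 1)) H)
        + cub (X (Sum.inl 0)) (X (Sum.inl 1))
          * shift (pderiv (Sum.inr (k - 1)) (pderiv (Sum.inr 0) H)) := by
  rw [bup, sub_add_cancel, map_add, pderiv_mul, pderiv_mul, pderiv_inr_cub, pderiv_inr_cub,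
    zero_mul, zero_add, zero_mul, zero_add, pderiv_inr_shift']

/-! ### The rows of the strain identity -/

/-- **Row `0`** (MATH §4.2): `∂_{p_0}` of `(β) A⁺F + B↑_{D-1} H = 0` reads
`A⁺ a_0 + Σ_y (∂_{q_0} a_y) p_y = -cub(q_D, q_{D-1})·Ξ` with `Ξ = ∂_{p_0}∂_{p_{D-1}} H`
(the term `cub(q_0,q_1)·S(∂_{p_{-1}}∂_{p_0} H)` vanishes: `H` has no site `-1`). [folklore] -/
theorem plin_row_zero {D : ℤ} (hD : 1 ≤ D) {a : ℤ → R} {H : R}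
    (ha : ∀ y, a y ∈ supported ℝ (Sum.inl '' Set.Icc (0 : ℤ) D))
    (hH : H ∈ supported ℝ (Var.site ⁻¹' Set.Icc (0 : ℤ) (D - 1)))
    (hβ : Aplus (∑ y ∈ Finset.Icc 0 D, a y * X (Sum.inr y)) + bup (D - 1) H = 0) :
    Aplus (a 0) + ∑ y ∈ Finset.Icc 0 D, pderiv (Sum.inl 0) (a y) * X (Sum.inr y) =
      -(cub (X (Sum.inl D)) (X (Sum.inl (D - 1)))
          * pderiv (Sum.inr 0) (pderiv (Sum.inr (D - 1)) H)) := by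
  have h := congrArg (pderiv (Sum.inr 0)) hβ
  rw [map_zero, map_add, pderiv_inr_Aplus_plin' ha (Finset.mem_Icc.mpr ⟨le_rfl, by omega⟩),
    pderiv_inr_bup_pred', zero_sub,
    pderiv_inr_eq_zero_of_site' (k := -1) (pderiv_mem_supported hH _) (Or.inl (by norm_num)),
    map_zero, mul_zero, add_zero] at h
  exact eq_neg_of_add_eq_zero_left h

/-- **Row `D`** (MATH §4.2): `∂_{p_D}` of `(β)` reads
`A⁺ a_D + Σ_y (∂_{q_D} a_y) p_y = -cub(q_0, q_1)·S Ξ` (the term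
`cub(q_D,q_{D-1})·∂_{p_D}∂_{p_{D-1}} H` vanishes: `H` has no site `D`). [folklore] -/
theorem plin_row_D {D : ℤ} (hD : 1 ≤ D) {a : ℤ → R} {H : R}
    (ha : ∀ y, a y ∈ supported ℝ (Sum.inl '' Set.Icc (0 : ℤ) D))
    (hH : H ∈ supported ℝ (Var.site ⁻¹' Set.Icc (0 : ℤ) (D - 1)))
    (hβ : Aplus (∑ y ∈ Finset.Icc 0 D, a y * X (Sum.inr y)) + bup (D - 1) H = 0) :
    Aplus (a D) + ∑ y ∈ Finset.Icc 0 D, pderiv (Sum.inl D) (a y) * X (Sum.inr y) =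
      -(cub (X (Sum.inl 0)) (X (Sum.inl 1))
          * shift (pderiv (Sum.inr 0) (pderiv (Sum.inr (D - 1)) H))) := by
  have h := congrArg (pderiv (Sum.inr D)) hβ
  rw [map_zero, map_add, pderiv_inr_Aplus_plin' ha (Finset.mem_Icc.mpr ⟨by omega, le_rfl⟩),
    pderiv_inr_bup_pred',
    pderiv_inr_eq_zero_of_site' (k := D) (pderiv_mem_supported hH _) (Or.inr (by omega)),
    mul_zero, zero_add, pderiv_comm (Sum.inr (D - 1)) (Sum.inr 0) H] at h
  exact eq_neg_of_add_eq_zero_left h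

/-- **The transport identities `(★)_y`** (MATH §4.3): eliminating `Ξ` between Row `0` and Row `D`
(`cub(q_0,q_1)·S(Row 0) = cub(q_{D+1},q_D)·(Row D)`) and extracting the coefficient of `p_y`:
`cub(q_0,q_1)·S(∂_{q_0} a_{y-1} + ∂_{q_{y-1}} a_0) = cub(q_{D+1},q_D)·(∂_{q_D} a_y + ∂_{q_y} a_D)`
for every `y ∈ ℤ`. [folklore] -/
theorem plin_transport {D : ℤ} (hD : 1 ≤ D) {a : ℤ → R} {H : R}
    (ha : ∀ y, a y ∈ supported ℝ (Sum.inl '' Set.Icc (0 : ℤ) D))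
    (hout : ∀ y, y < 0 ∨ D < y → a y = 0)
    (hH : H ∈ supported ℝ (Var.site ⁻¹' Set.Icc (0 : ℤ) (D - 1)))
    (hβ : Aplus (∑ y ∈ Finset.Icc 0 D, a y * X (Sum.inr y)) + bup (D - 1) H = 0) (y : ℤ) :
    cub (X (Sum.inl 0)) (X (Sum.inl 1))
        * shift (pderiv (Sum.inl 0) (a (y - 1)) + pderiv (Sum.inl (y - 1)) (a 0)) =
      cub (X (Sum.inl (D + 1))) (X (Sum.inl D))
        * (pderiv (Sum.inl D) (a y) + pderiv (Sum.inl y) (a D)) := by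
  have key : cub (X (Sum.inl 0)) (X (Sum.inl 1))
        * shift (Aplus (a 0) + ∑ z ∈ Finset.Icc 0 D, pderiv (Sum.inl 0) (a z) * X (Sum.inr z)) =
      cub (X (Sum.inl (D + 1))) (X (Sum.inl D))
        * (Aplus (a D) + ∑ z ∈ Finset.Icc 0 D, pderiv (Sum.inl D) (a z) * X (Sum.inr z)) := by
    rw [plin_row_zero hD ha hH hβ, plin_row_D hD ha hH hβ, map_neg, map_mul, shift_cub,
      shift_X_inl, shift_X_inl, sub_add_cancel]
    ring
  have h := congrArg (pderiv (Sum.inr y)) key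
  rw [pderiv_mul, pderiv_inr_cub, zero_mul, zero_add, pderiv_inr_shift',
    pderiv_inr_row' ha hout, pderiv_mul, pderiv_inr_cub, zero_mul, zero_add,
    pderiv_inr_row' ha hout] at h
  rw [add_comm (pderiv (Sum.inl 0) (a (y - 1))), add_comm (pderiv (Sum.inl D) (a y))]
  exact h

/-- **`(H2)`** (MATH §4.2): the `p_D`-coefficient of Row `0` is `∂_{q_0} a_D + ∂_{q_D} a_0 = 0`
(`Ξ` has no `p_D`). [folklore] -/
theorem plin_h2 {D : ℤ} (hD : 1 ≤ D) {a : ℤ → R} {H : R}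
    (ha : ∀ y, a y ∈ supported ℝ (Sum.inl '' Set.Icc (0 : ℤ) D))
    (hout : ∀ y, y < 0 ∨ D < y → a y = 0)
    (hH : H ∈ supported ℝ (Var.site ⁻¹' Set.Icc (0 : ℤ) (D - 1)))
    (hβ : Aplus (∑ y ∈ Finset.Icc 0 D, a y * X (Sum.inr y)) + bup (D - 1) H = 0) :
    pderiv (Sum.inl 0) (a D) + pderiv (Sum.inl D) (a 0) = 0 := by
  have h := congrArg (pderiv (Sum.inr D)) (plin_row_zero hD ha hH hβ)
  rw [pderiv_inr_row' ha hout, map_neg, pderiv_mul, pderiv_inr_cub, zero_mul, zero_add,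
    pderiv_inr_eq_zero_of_site' (k := D)
      (pderiv_mem_supported (pderiv_mem_supported hH _) _) (Or.inr (by omega)),
    mul_zero, neg_zero] at h
  rwa [add_comm] at h

/-- **The restricted entries** (MATH §4.5, first half): for `x, y ∈ [0, D-1]`, applying
`∂_{p_x}∂_{p_y}`, then `killP` (`p ↦ 0`), then `θ = killVar q_D` to `(β)` gives
`θ(∂_{q_x} a_y + ∂_{q_y} a_x) = -θ(cub(q_0,q_1))·W_{xy}` with
`W_{xy} = θ(killP(S(∂_{p_{x-1}}∂_{p_{y-1}}∂_{p_0} H)))`, which is free of `q_0` and vanishes for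
`x = 0` or `y = 0` (`H` has no site `-1`); the `cub(q_D, q_{D-1})`-term dies under `θ`.
[folklore] -/
theorem plin_restricted {D : ℤ} (hD : 1 ≤ D) {a : ℤ → R} {H : R}
    (ha : ∀ y, a y ∈ supported ℝ (Sum.inl '' Set.Icc (0 : ℤ) D))
    (hH : H ∈ supported ℝ (Var.site ⁻¹' Set.Icc (0 : ℤ) (D - 1)))
    (hβ : Aplus (∑ y ∈ Finset.Icc 0 D, a y * X (Sum.inr y)) + bup (D - 1) H = 0) {x y : ℤ}
    (hx0 : 0 ≤ x) (hxD : x ≤ D - 1) (hy0 : 0 ≤ y) (hyD : y ≤ D - 1) :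
    ∃ W : R, pderiv (Sum.inl 0) W = 0 ∧ (x = 0 ∨ y = 0 → W = 0) ∧
      killVar (Sum.inl D) (pderiv (Sum.inl x) (a y) + pderiv (Sum.inl y) (a x)) =
        -(killVar (Sum.inl D) (cub (X (Sum.inl 0)) (X (Sum.inl 1))) * W) := by
  have hg : pderiv (Sum.inr (x - 1)) (pderiv (Sum.inr (y - 1)) (pderiv (Sum.inr 0) H)) ∈
      supported ℝ (Var.site ⁻¹' Set.Icc (0 : ℤ) (D - 1)) :=
    pderiv_mem_supported (pderiv_mem_supported (pderiv_mem_supported hH _) _) _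
  have h0D : (Sum.inl 0 : Var) ≠ Sum.inl D := fun e => by
    have := Sum.inl_injective e
    omega
  refine ⟨killVar (Sum.inl D) (killP (shift
    (pderiv (Sum.inr (x - 1)) (pderiv (Sum.inr (y - 1)) (pderiv (Sum.inr 0) H))))), ?_, ?_, ?_⟩
  · rw [pderiv_killVar_of_ne h0D, pderiv_inl_killP, pderiv_inl_shift', zero_sub,
      pderiv_inl_eq_zero_of_site' hg (Or.inl (by norm_num))]
    simp only [map_zero]
  · rintro (rfl | rfl)
    · rw [zero_sub, pderiv_inr_eq_zero_of_site' (k := -1)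
        (pderiv_mem_supported (pderiv_mem_supported hH _) _) (Or.inl (by norm_num))]
      simp only [map_zero]
    · rw [zero_sub, pderiv_inr_eq_zero_of_site' (k := -1) (pderiv_mem_supported hH _)
        (Or.inl (by norm_num))]
      simp only [map_zero]
  · have hx : x ∈ Finset.Icc 0 D := Finset.mem_Icc.mpr ⟨hx0, by omega⟩
    have hy : y ∈ Finset.Icc 0 D := Finset.mem_Icc.mpr ⟨hy0, by omega⟩
    have e1 : pderiv (Sum.inr x) (pderiv (Sum.inr y)
        (Aplus (∑ z ∈ Finset.Icc 0 D, a z * X (Sum.inr z)))) =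
        pderiv (Sum.inl x) (a y) + pderiv (Sum.inl y) (a x) := by
      rw [pderiv_inr_Aplus_plin' ha hy, map_add, pderiv_inr_Aplus_coef' ha,
        pderiv_inr_plin' (pderiv_inr_pderiv_coef' ha x y), if_pos hx]
    have e2 : pderiv (Sum.inr x) (pderiv (Sum.inr y) (bup (D - 1) H)) =
        cub (X (Sum.inl D)) (X (Sum.inl (D - 1)))
            * pderiv (Sum.inr x) (pderiv (Sum.inr y) (pderiv (Sum.inr (D - 1)) H))
          + cub (X (Sum.inl 0)) (X (Sum.inl 1)) * shift
              (pderiv (Sum.inr (x - 1)) (pderiv (Sum.inr (y - 1)) (pderiv (Sum.inr 0) H))) := by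
      rw [pderiv_inr_bup_pred', map_add, pderiv_mul, pderiv_inr_cub, zero_mul, zero_add,
        pderiv_mul, pderiv_inr_cub, zero_mul, zero_add, pderiv_inr_shift']
    have e3 : pderiv (Sum.inl x) (a y) + pderiv (Sum.inl y) (a x)
        + (cub (X (Sum.inl D)) (X (Sum.inl (D - 1)))
            * pderiv (Sum.inr x) (pderiv (Sum.inr y) (pderiv (Sum.inr (D - 1)) H))
          + cub (X (Sum.inl 0)) (X (Sum.inl 1)) * shift
              (pderiv (Sum.inr (x - 1)) (pderiv (Sum.inr (y - 1)) (pderiv (Sum.inr 0) H)))) =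
        0 := by
      rw [← e1, ← e2, ← map_add, ← map_add, hβ, map_zero, map_zero]
    have e4 := congrArg (fun G => killVar (Sum.inl D) (killP G)) e3
    simp only [map_add, map_mul, map_zero, killP_pderiv_coef' ha, killP_cub',
      killVar_inl_cub_left (show D ≠ D - 1 by omega), zero_mul, zero_add] at e4
    rw [map_add]
    linear_combination e4

/-- **The rows of the strain identity of a p-linear leading member** (MATH §4.1–4.5): for
`1 ≤ D`, coefficients `a_y ∈ ℝ[q_0, …, q_D]` vanishing off `[0, D]`, `H` on the sites
`0, …, D-1` and `(β) A⁺(Σ_y a_y p_y) + B↑_{D-1} H = 0`: Row `0`, Row `D`, the transport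
identities `(★)_y`, `(H2)`, and the restricted entries on `q_D = 0`. [folklore] -/
theorem pair_linear_rows : ∀ {D : ℤ}, 1 ≤ D → ∀ (a : ℤ → R) (H : R),
    (∀ y, a y ∈ supported ℝ (Sum.inl '' Set.Icc (0 : ℤ) D)) →
    (∀ y, y < 0 ∨ D < y → a y = 0) →
    H ∈ supported ℝ (Var.site ⁻¹' Set.Icc (0 : ℤ) (D - 1)) →
    Aplus (∑ y ∈ Finset.Icc 0 D, a y * X (Sum.inr y)) + bup (D - 1) H = 0 →
    (Aplus (a 0) + ∑ y ∈ Finset.Icc 0 D, pderiv (Sum.inl 0) (a y) * X (Sum.inr y) =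
        -(cub (X (Sum.inl D)) (X (Sum.inl (D - 1)))
            * pderiv (Sum.inr 0) (pderiv (Sum.inr (D - 1)) H))) ∧
    (Aplus (a D) + ∑ y ∈ Finset.Icc 0 D, pderiv (Sum.inl D) (a y) * X (Sum.inr y) =
        -(cub (X (Sum.inl 0)) (X (Sum.inl 1))
            * shift (pderiv (Sum.inr 0) (pderiv (Sum.inr (D - 1)) H)))) ∧
    (∀ y : ℤ, cub (X (Sum.inl 0)) (X (Sum.inl 1))
          * shift (pderiv (Sum.inl 0) (a (y - 1)) + pderiv (Sum.inl (y - 1)) (a 0)) =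
        cub (X (Sum.inl (D + 1))) (X (Sum.inl D))
          * (pderiv (Sum.inl D) (a y) + pderiv (Sum.inl y) (a D))) ∧
    (pderiv (Sum.inl 0) (a D) + pderiv (Sum.inl D) (a 0) = 0) ∧
    (∀ x y : ℤ, 0 ≤ x → x ≤ D - 1 → 0 ≤ y → y ≤ D - 1 → ∃ W : R,
        pderiv (Sum.inl 0) W = 0 ∧ (x = 0 ∨ y = 0 → W = 0) ∧
        killVar (Sum.inl D) (pderiv (Sum.inl x) (a y) + pderiv (Sum.inl y) (a x)) =
          -(killVar (Sum.inl D) (cub (X (Sum.inl 0)) (X (Sum.inl 1))) * W)) := by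
  intro D hD a H ha hout hH hβ
  exact ⟨plin_row_zero hD ha hH hβ, plin_row_D hD ha hH hβ, plin_transport hD ha hout hH hβ,
    plin_h2 hD ha hout hH hβ,
    fun x y hx0 hxD hy0 hyD => plin_restricted hD ha hH hβ hx0 hxD hy0 hyD⟩

end Summit.AtomisticToContinuum.FouriersLaw.Theorems.OddChargeAlgebra

end
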